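import Mathlib
import HarnessLib
import Summits.Ventures.LatticeQCDFlow.Exactness.CoordinateHaar

/-!
# Haar on `SU(N)` is dominated by the lexicographic product of SU(2)-pair Haar measures

HONEST FRAMING: exact (Metropolis-corrected) sampling algorithms for lattice gauge theory;
figures of merit are autocorrelation/cost numbers at stated couplings and volumes; no
continuum-physics claim.

Venture `LatticeQCDFlow` (cell pub-lqcd), topic `Exactness`, FANOUT row 9 (eng-latcore, the
engine `latflow.core`; `update_link` in `csrc/latcore_template.c` runs one Cabibbo–Marinari
heat-bath hit per coordinate pair `(i, j)`, `i < j`, lexicographically).  NEW WORK of the cell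
over Mathlib and row 9's earlier files; nothing is cited as a fact.  Printed counterparts, NAMED
ONLY: Diaconis–Shahshahani 1987 (subgroup algorithm); Meyn–Tweedie 1993 Thm 16.0.2 (Doeblin ⇒
uniform ergodicity); Cabibbo–Marinari 1982 (the update).  Part of the proof that the SU(N ≥ 3)
Cabibbo–Marinari heat bath is uniformly ergodic.

## What is proved (`n` a finite nonempty index type; `SU(N) = Matrix.specialUnitaryGroup n ℂ`)

* §0 `SU(N)` and the sphere `S^{2N−1}` are Polish spaces (instances for the Suslin transfer).
* §1 `pairLaw'` (total pair law), `blockLaw a l` (the block of kicks `(a, j)`, `j ∈ l`),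
  `blockLaw_compl`, `map_orbMap_mconv`; **`subLaw_le_blockLaw_map_orbMap`** (SPREAD): the uniform
  law of the sub-sphere of `{a} ∪ l` is dominated by a constant times the orbit law of the block —
  induction on `l` with `subLaw_insert_le`.
* §2 `lexLaw L` (block of the head, then the rest — the engine's double loop `i < j`);
  **`subHaar_le_lexLaw`** (MAIN): `subHaar L.toFinset ≤ C • lexLaw L`, `C < ∞` — induction on `L`:
  the coset lemma `le_smul_mconv_of_le_on_invariant` with `K = coordSubgroup (tail)`, its hypothesis
  supplied by the Suslin transfer `le_on_invariant_of_map_le` from SPREAD; base `SU(1) = 1`.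
  **`haar_le_lexLaw`**, **`smul_haar_le_lexLaw`**: for `a₀ < a₁ < ⋯` the increasing enumeration of
  the coordinates, `c • Haar_{SU(N)} ≤ lexLaw`, `c > 0` — the law of the lexicographic product of
  independent Haar-distributed SU(2) pair elements has a component of size `c` distributed exactly
  by Haar.

NOT CLAIMED: any estimate of the constant (the proof gives a product of `2^{2N} × radial` constants); other orders of the pairs (only the lexicographic word and, in the next file, its reverse).
-/

namespace Summit.Ventures.LatticeQCDFlow.Exactness

open Matrix MeasureTheory WithLp Metric Complex ProbabilityTheory Measure Set
open scoped ENNReal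

variable {n : Type*} [Fintype n] [DecidableEq n]

/-! ## §0 Descriptive-set-theoretic instances: `SU(N)` and the sphere are Polish -/

section Polish

/-- `Matrix n n ℂ = n → n → ℂ` is Polish (the type synonym hides the `Pi` instance). -/
instance polishSpace_matrix : PolishSpace (Matrix n n ℂ) := inferInstanceAs (PolishSpace (n → n → ℂ))

/-- `SU(N)`, a closed (compact) subset of the matrices, is Polish. -/
instance polishSpace_specialUnitaryGroup : PolishSpace (Matrix.specialUnitaryGroup n ℂ) :=
  (IsClosed.isClosedEmbedding_subtypeVal (isCompact_iff_compactSpace.mpr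
    (inferInstance : CompactSpace (Matrix.specialUnitaryGroup n ℂ))).isClosed).polishSpace

/-- The unit sphere of `ℝ^{2N}` is Polish. -/
instance polishSpace_sphere : PolishSpace (S n) := (isClosed_sphere : IsClosed (sphere (0 : E n) 1)).polishSpace

end Polish

/-! ## §1 Blocks of pair kicks and the SPREAD inequality -/

section Spread

variable [Nonempty n]

/-- The pair law, extended by `δ₁` on the (never used) diagonal `a = b`. -/
noncomputable def pairLaw' (a b : n) : Measure (Matrix.specialUnitaryGroup n ℂ) :=
  if h : a = b then Measure.dirac 1 else pairLaw a b h

omit [Nonempty n] in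
/-- Off the diagonal it is the pair law. -/
theorem pairLaw'_of_ne {a b : n} (hab : a ≠ b) : pairLaw' a b = pairLaw a b hab := dif_neg hab

/-- It is a probability measure. -/
instance isProbabilityMeasure_pairLaw' (a b : n) : IsProbabilityMeasure (pairLaw' a b) := by
  unfold pairLaw'
  split_ifs <;> infer_instance

omit [Nonempty n] in
/-- It is carried by every coordinate subgroup containing both indices. -/
theorem pairLaw'_compl {s : Finset n} {a b : n} (ha : a ∈ s) (hb : b ∈ s) :
    pairLaw' a b (coordSubgroup s : Set (Matrix.specialUnitaryGroup n ℂ))ᶜ = 0 := by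
  unfold pairLaw'
  split_ifs with h
  · rw [Measure.dirac_apply' _ (isClosed_coordSubgroup s).measurableSet.compl, Set.indicator_of_notMem]
    exact fun h1 => h1 (coordSubgroup s).one_mem
  · rw [← mem_ae_iff]
    filter_upwards [ae_pairLaw_mem a b h] with g hg
    exact coordSubgroup_mono (by
      intro x hx
      simp only [Finset.mem_insert, Finset.mem_singleton] at hx
      rcases hx with rfl | rfl <;> assumption) hg

/-- **The block of `a`**: the law of the ordered product of independent kicks in the pairs
`(a, j)`, `j` running through the list `l` (the engine's loop over `j > i` for fixed `i`). -/
noncomputable def blockLaw (a : n) (l : List n) : Measure (Matrix.specialUnitaryGroup n ℂ) :=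
  listConv (l.map (pairLaw' a))

/-- It is a probability measure. -/
instance isProbabilityMeasure_blockLaw (a : n) (l : List n) : IsProbabilityMeasure (blockLaw a l) :=
  isProbabilityMeasure_listConv _ fun μ hμ => by
    obtain ⟨j, -, rfl⟩ := List.mem_map.1 hμ
    infer_instance

omit [Nonempty n] in
/-- It is carried by every coordinate subgroup containing `a` and the list. -/
theorem blockLaw_compl {s : Finset n} {a : n} (ha : a ∈ s) {l : List n} (hl : ∀ j ∈ l, j ∈ s) :
    blockLaw a l (coordSubgroup s : Set (Matrix.specialUnitaryGroup n ℂ))ᶜ = 0 :=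
  listConv_compl_eq_zero (coordSubgroup s) (isClosed_coordSubgroup s).measurableSet _
    (fun μ hμ => by obtain ⟨j, -, rfl⟩ := List.mem_map.1 hμ; infer_instance)
    (fun μ hμ => by obtain ⟨j, hj, rfl⟩ := List.mem_map.1 hμ; exact pairLaw'_compl ha (hl j hj))

omit [Nonempty n] in
/-- Convolution then orbit map = kick of the orbit law: `(μ ∗ ρ)·e_i = μ • (ρ·e_i)` in law. -/
theorem map_orbMap_mconv (i : n) (μ ρ : Measure (Matrix.specialUnitaryGroup n ℂ)) [SFinite μ] [SFinite ρ] :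
    (μ ∗ₘ ρ).map (orbMap i) = (μ.prod (ρ.map (orbMap i))).map (fun p => actSU p.1 p.2) := by
  rw [Measure.mconv, Measure.map_map (measurable_orbMap i) measurable_mul,
    prod_map_right_eq_map_prodMap _ _ (measurable_orbMap i),
    Measure.map_map continuous_actSU.measurable (measurable_id.prodMap (measurable_orbMap i))]
  congr 1
  funext p
  simp [orbMap_mul]

/-- **SPREAD**: for a nonempty list `l` of distinct coordinates not containing `a`, the uniform law
of the sub-sphere of `{a} ∪ l` is dominated by a constant times the orbit law (image of `e_a`) of
the block of kicks `(a, j)`, `j ∈ l`.  Induction on `l` with the spreading inequality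
`subLaw_insert_le`; base case = the orbit law of one pair kick (`pairLaw_map_orbMap`). -/
theorem subLaw_le_blockLaw_map_orbMap (a : n) :
    ∀ (l : List n), l ≠ [] → l.Nodup → a ∉ l →
      ∃ C : ℝ≥0∞, C ≠ ∞ ∧ subLaw (insert a l.toFinset) ≤ C • (blockLaw a l).map (orbMap a)
  | [], h, _, _ => absurd rfl h
  | [j], _, _, haj => by
      have hja : a ≠ j := fun h => haj (by simp [h])
      refine ⟨1, ENNReal.one_ne_top, le_of_eq ?_⟩
      rw [one_smul, blockLaw, List.map_singleton, listConv_cons, listConv_nil, Measure.mconv_dirac_one,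
        pairLaw'_of_ne hja, pairLaw_map_orbMap a j hja]
      simp
  | j :: k :: l, _, hnd, hajl => by
      have hja : a ≠ j := fun h => hajl (by simp [h])
      have hal : a ∉ k :: l := fun h => hajl (List.mem_cons_of_mem j h)
      have hjl : j ∉ k :: l := (List.nodup_cons.1 hnd).1
      obtain ⟨C', hC', hIH⟩ := subLaw_le_blockLaw_map_orbMap a (k :: l) (List.cons_ne_nil k l)
        (List.nodup_cons.1 hnd).2 hal
      -- the spreading step with `s' = {a} ∪ (k :: l)`, new coordinate `j`
      have has' : a ∈ insert a (k :: l).toFinset := Finset.mem_insert_self a _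
      have hjs' : j ∉ insert a (k :: l).toFinset := by
        rw [Finset.mem_insert, List.mem_toFinset]; push Not; exact ⟨hja.symm, hjl⟩
      obtain ⟨C, hC, hstep⟩ := subLaw_insert_le (insert a (k :: l).toFinset) has' hjs'
      refine ⟨C * C', ENNReal.mul_ne_top hC hC', ?_⟩
      have hins : insert a (j :: k :: l).toFinset = insert j (insert a (k :: l).toFinset) := by
        rw [List.toFinset_cons, Finset.insert_comm]
      have hblock : blockLaw a (j :: k :: l) = pairLaw a j hja ∗ₘ blockLaw a (k :: l) := by
        rw [blockLaw, List.map_cons, listConv_cons, pairLaw'_of_ne hja]; rfl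
      rw [hins, hblock, map_orbMap_mconv, ← smul_smul]
      refine hstep.trans (measure_smul_le_smul_of_le ?_ C)
      have hpair : (pairLaw a j (ne_of_mem_of_not_mem has' hjs')) = pairLaw a j hja := rfl
      rw [hpair, ← Measure.map_smul, ← Measure.prod_smul_right]
      exact Measure.map_mono (Measure.prod_mono le_rfl hIH) continuous_actSU.measurable

end Spread

/-! ## §2 The lexicographic product of pair kicks dominates Haar on every coordinate subgroup -/

section Main

variable [Nonempty n]

/-- **The lexicographic law**: for a list of coordinates `a₀, a₁, …`, the law of the ordered product
of independent SU(2) kicks in the pairs `(a₀,a₁), (a₀,a₂), …, (a₁,a₂), …` — block of `a₀`, then the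
lexicographic law of the rest (the engine's double loop `i < j`). -/
noncomputable def lexLaw : List n → Measure (Matrix.specialUnitaryGroup n ℂ)
  | [] => Measure.dirac 1
  | a :: l => blockLaw a l ∗ₘ lexLaw l

omit [Nonempty n] in
/-- Unfolding. -/
theorem lexLaw_cons (a : n) (l : List n) : lexLaw (a :: l) = blockLaw a l ∗ₘ lexLaw l := rfl

/-- It is a probability measure. -/
instance isProbabilityMeasure_lexLaw : ∀ (l : List n), IsProbabilityMeasure (lexLaw l)
  | [] => by rw [lexLaw]; infer_instance
  | a :: l => by
      haveI := isProbabilityMeasure_lexLaw l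
      rw [lexLaw_cons]; infer_instance

/-- **MAIN**: the Haar probability of the coordinate subgroup of a nonempty list of distinct
coordinates is dominated by a constant times the lexicographic law of the list.  Induction: the
coset lemma (`le_smul_mconv_of_le_on_invariant`) with `K =` the coordinate subgroup of the tail,
its hypothesis transferred from the orbit laws (`le_on_invariant_of_map_le`, Suslin) where it is
SPREAD; base case `SU(1) = 1`. -/
theorem subHaar_le_lexLaw :
    ∀ (l : List n), l ≠ [] → l.Nodup → ∃ C : ℝ≥0∞, C ≠ ∞ ∧ subHaar l.toFinset ≤ C • lexLaw l
  | [], h, _ => absurd rfl h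
  | [a], _, _ => by
      refine ⟨1, ENNReal.one_ne_top, le_of_eq ?_⟩
      rw [one_smul, lexLaw_cons, lexLaw, blockLaw, List.map_nil, listConv_nil, Measure.mconv_dirac_one,
        List.toFinset_cons, List.toFinset_nil, Finset.insert_empty, subHaar_singleton]
  | a :: b :: l, _, hnd => by
      have hal : a ∉ b :: l := (List.nodup_cons.1 hnd).1
      obtain ⟨C', hC', hIH⟩ := subHaar_le_lexLaw (b :: l) (List.cons_ne_nil b l) (List.nodup_cons.1 hnd).2
      obtain ⟨C₁, hC₁, hspread⟩ := subLaw_le_blockLaw_map_orbMap a (b :: l) (List.cons_ne_nil b l)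
        (List.nodup_cons.1 hnd).2 hal
      set S' : Finset n := (b :: l).toFinset with hS'
      set S : Finset n := (a :: b :: l).toFinset with hS
      have hSins : S = insert a S' := by rw [hS, List.toFinset_cons]
      have haS : a ∈ S := by rw [hSins]; exact Finset.mem_insert_self a S'
      have hS'S : S' ⊆ S := by rw [hSins]; exact Finset.subset_insert a S'
      have haS' : a ∉ S' := by rwa [hS', List.mem_toFinset]
      have hSerase : S.erase a = S' := by rw [hSins, Finset.erase_insert haS']
      have hScard : 2 ≤ S.card := by
        rw [hSins, Finset.card_insert_of_notMem haS', hS', List.toFinset_cons]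
        have := Finset.card_pos.2 ⟨b, Finset.mem_insert_self b l.toFinset⟩
        omega
      refine ⟨C₁ * C', ENNReal.mul_ne_top hC₁ hC', ?_⟩
      -- the coset lemma
      have hcoset : subHaar S ≤ C₁ • (blockLaw a (b :: l) ∗ₘ subHaar S') := by
        refine le_smul_mconv_of_le_on_invariant (K := (coordSubgroup S' : Set (Matrix.specialUnitaryGroup n ℂ)))
          (fun k hk => subHaar_map_mul_left hk) (subHaar_mconv_subHaar hS'S) fun B hB hBK => ?_
        refine le_on_invariant_of_map_le (L := (coordSubgroup S : Set (Matrix.specialUnitaryGroup n ℂ)))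
          (continuous_orbMap a) (isClosed_coordSubgroup S).isCompact ?_ (subHaar_compl S)
          (blockLaw_compl (l := b :: l) haS fun j hj => hS'S (List.mem_toFinset.2 hj)) ?_ hB hBK
        · intro x hx y hy hxy
          have h := inv_mul_mem_coordSubgroup_erase hx hy hxy
          rwa [hSerase] at h
        · rw [subHaar_map_orbMap hScard haS, hSins]
          exact hspread
      rw [hS] at hcoset
      rw [lexLaw_cons, ← smul_smul]
      refine hcoset.trans (measure_smul_le_smul_of_le ?_ C₁)
      rw [← mconv_smul_right]
      exact mconv_mono le_rfl hIH

/-- **Haar on `SU(N)` is dominated by the lexicographic product of SU(2)-pair Haar measures**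
(`N ≥ 2`, coordinates in increasing order): `haar ≤ C • lexLaw [a₀ < a₁ < ⋯]`, `C < ∞`. -/
theorem haar_le_lexLaw [LinearOrder n] :
    ∃ C : ℝ≥0∞, C ≠ ∞ ∧
      Literature.MathematicalPhysics.QuantumFieldTheory.haarProbability (Matrix.specialUnitaryGroup n ℂ) ≤
        C • lexLaw (Finset.univ.sort (· ≤ ·) : List n) := by
  have hne : (Finset.univ.sort (· ≤ ·) : List n) ≠ [] := by
    intro h
    have h1 := Finset.length_sort (α := n) (· ≤ ·) (s := Finset.univ)
    rw [h, List.length_nil, Finset.card_univ] at h1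
    exact Fintype.card_ne_zero h1.symm
  obtain ⟨C, hC, h⟩ := subHaar_le_lexLaw _ hne (Finset.sort_nodup _ _)
  refine ⟨C, hC, ?_⟩
  rwa [Finset.sort_toFinset, subHaar_univ] at h

/-- … equivalently **`c • haar ≤ lexLaw`** for some `c > 0`: the lexicographic product of
Haar-distributed SU(2) pair elements has a component of size `c` distributed EXACTLY by Haar. -/
theorem smul_haar_le_lexLaw [LinearOrder n] :
    ∃ c : ℝ≥0∞, c ≠ 0 ∧
      c • Literature.MathematicalPhysics.QuantumFieldTheory.haarProbability (Matrix.specialUnitaryGroup n ℂ) ≤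
        lexLaw (Finset.univ.sort (· ≤ ·) : List n) := by
  obtain ⟨C, hC, h⟩ := haar_le_lexLaw (n := n)
  have hC0 : C ≠ 0 := by
    intro h0
    rw [h0, zero_smul] at h
    have h1 := Measure.le_iff'.1 h Set.univ
    rw [measure_univ, Measure.coe_zero, Pi.zero_apply] at h1
    exact absurd h1 (by simp)
  refine ⟨C⁻¹, ENNReal.inv_ne_zero.2 hC, ?_⟩
  calc C⁻¹ • Literature.MathematicalPhysics.QuantumFieldTheory.haarProbability (Matrix.specialUnitaryGroup n ℂ)
      ≤ C⁻¹ • (C • lexLaw (Finset.univ.sort (· ≤ ·) : List n)) := measure_smul_le_smul_of_le h _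
    _ = lexLaw (Finset.univ.sort (· ≤ ·) : List n) := by
        rw [smul_smul, ENNReal.inv_mul_cancel hC0 hC, one_smul]

end Main

end Summit.Ventures.LatticeQCDFlow.Exactness
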